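import Mathlib
import HarnessLib

/-!
# Route `KLProgramme` — engine support (route (L2), FIRST MOMENT, cure (c-D)): the RATE ARITHMETIC of the flow-piece increment pair — the six
# rate inequalities of `…SectorSliceIncrPairMoment.sliceIncrPairWt_charSum_l1_le` SOLVED in the two-scale class of a flow piece

Cell `gate-hubbard-kl`, seat hubbard-kl-k3c3-p2 (g9), for the ENGINE child stmt-HubbardSuperconductivity-20437 (`stub_engine_step_norms`, WEIGHTED lines
at internal levels; v2 conditional token #19 `klWtBudget ↦ klWtBudget·klWtAllow`; located risk «(b)-Wt@j≥1», evidence #48 CD-LIMITS §1).  Pure real algebra.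

The increment pair lemma asks, for an amplitude `A₀` and rates `s₀, s₁, s₂, s₃, s₃′`, six inequalities «Leibniz bound ≤ A₀·(4/(s_w P_w))^k» whose left
sides are explicit polynomials in the slice constants `K_r = κ_r·c/Λ^{r+1}` (`κ₁ = 16B₁+16`, …), the piece data `P₀ … P₃`, the band data `K₁ᵇ … K₃ᵇ`,
the multiplier differences `a_k` and the step norm `η = ‖w‖`.  In the TWO-SCALE CLASS of a flow piece at depth `x = 4^m ≥ 1`
(`P₀ = G₀/x²`, `P₁ = G₁/x`, `P₂ = G₂`, `P₃ = G₃·x`; band `K₁ᵇ = b₁`, `K₂ᵇ = b₂ + b₂′x`, `K₃ᵇ = b₃ + b₃′x`; multiplier data in scale form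
`a_k ≤ α_k η^k`) and with the amplitude `A₀ = 2·c₀·K₁·P₀` and the rates `s = ρ/x` (order three, all four space directions, `|u|`-scaled by the caller)
and `s₃ = ρ₃/x` (order two along the sector), each space inequality reduces to THREE (resp. TWO) explicit threshold conditions
`3·X_i ≤ K₁′G₃·x^i` (resp. `2·Y_i ≤ K₁′G₂·x^i`), `K₁′ = κ₁/Λ²`, monotone in `x`, plus the `x`-free rate conditions `G₃ρ³ ≤ (2/π)³G₀`,
`G₂ρ₃² ≤ (2/π)²G₀` (CD-LIMITS §1: the order-three directions slowed by `λ_m ∝ 4^m`, the amplitude gain `16^{-m}`):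

* **`incr_rate_three_le`** — the order-three space inequality (axes `i = 0, 1`, normal `v⊥`, tangent `v`) in the two-scale class;
* **`incr_rate_two_le`** — the order-two tangent inequality;
* **`incr_rate_time_le`** — the time inequality from its `P₀`-free reduced form (a level condition, the same for every piece);
* **`norm_toLp_latticeStep`** — `‖(2π/L)·r‖ = (2π/L)·√(r₀² + r₁²)` (turns `2η/(πρ)` into the lemma's `4|r|/(ρL)`); **`div_pow_le_div_sq`**.

Everything is proved; no definitions, no named facts. [folklore]

References: G. Benfatto, A. Giuliani, V. Mastropietro, Ann. Henri Poincaré 7 (2006) 809–898, §2.8 (2.81), §3 (3.2)–(3.8).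
-/

noncomputable section

namespace Summit.HubbardSuperconductivity.HubbardSuperconductivity.Theorems.TorusFourierL2

set_option linter.dupNamespace false -- summit = problem name (single-conjunct summit), D-0017

open scoped Real

/-! ### §0 Two small helpers -/

/-- The Euclidean norm of the lattice step `(2π/L)·r`, `r ∈ ℤ²`: `‖(2π/L)·r‖ = (2π/L)·√(r₀² + r₁²)`. [folklore] -/
theorem norm_toLp_latticeStep (L : ℕ) (r : Fin 2 → ℤ) :
    ‖(WithLp.toLp 2 (fun j => 2 * π / L * (r j : ℝ)) : EuclideanSpace ℝ (Fin 2))‖ =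
      2 * π / L * Real.sqrt ((r 0 : ℝ) ^ 2 + (r 1 : ℝ) ^ 2) := by
  rw [EuclideanSpace.norm_eq, Fin.sum_univ_two]
  simp only [Real.norm_eq_abs, sq_abs]
  have h : 0 ≤ 2 * π / (L : ℝ) := by positivity
  rw [show (2 * π / L * (r 0 : ℝ)) ^ 2 + (2 * π / L * (r 1 : ℝ)) ^ 2 = (2 * π / L) ^ 2 * ((r 0 : ℝ) ^ 2 + (r 1 : ℝ) ^ 2) by ring,
    Real.sqrt_mul (by positivity), Real.sqrt_sq h]

/-- `C/x^k ≤ C/x²` for `C ≥ 0`, `x ≥ 1`, `k ≥ 2`. [folklore] -/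
theorem div_pow_le_div_sq {C x : ℝ} {k : ℕ} (hC : 0 ≤ C) (hx : 1 ≤ x) (hk : 2 ≤ k) : C / x ^ k ≤ C / x ^ 2 :=
  div_le_div_of_nonneg_left hC (by positivity) (pow_le_pow_right₀ hx hk)

/-! ### §1 Order three in the two-scale class -/

set_option maxHeartbeats 800000 in
/-- **Order-three space rate inequality of the increment pair, solved in the two-scale class.**  With `A₀ = 2c₀K₁P₀` and the rate `ρ/x`
(the caller divides by `|r|` and uses `norm_toLp_latticeStep`): the Leibniz bound of `sliceIncrPairWt_charSum_l1_le` in a space direction of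
step norm `η` is `≤ A₀·(2η/(πρ/x))³`, given the scale-form multiplier data `a_k ≤ α_kη^k`, the three threshold conditions and `G₃ρ³ ≤ (2/π)³G₀`.
(One disclosed heartbeat raise: statement size.) [cite: BenfattoGiulianiMastropietro2006, §3 (3.2)–(3.8)] -/
theorem incr_rate_three_le {c₀ c Λ B₁ B₂ B₃ B₄ k₁ k₂ k₃ k₄ P₀ P₁ P₂ P₃ Kb₁ Kb₂ Kb₃ G₀ G₁ G₂ G₃ b₁ b₂ b₂' b₃ b₃' a₁ a₂ a₃ α₁ α₂ α₃ η ρ x : ℝ}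
    (hc₀ : 0 ≤ c₀) (hc : 0 ≤ c)
    (hk₁ : k₁ = (16 * B₁ + 16) / Λ ^ 2) (hk₂ : k₂ = (32 * B₂ + 144 * B₁ + 128) / Λ ^ 3)
    (hk₃ : k₃ = (64 * B₃ + 480 * B₂ + 1728 * B₁ + 1536) / Λ ^ 4)
    (hk₄ : k₄ = (128 * B₄ + 1408 * B₃ + 7776 * B₂ + 27648 * B₁ + 24576) / Λ ^ 5)
    (hk₁0 : 0 ≤ k₁) (hk₂0 : 0 ≤ k₂) (hk₃0 : 0 ≤ k₃) (hk₄0 : 0 ≤ k₄)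
    (hP₀ : P₀ = G₀ / x ^ 2) (hP₁ : P₁ = G₁ / x) (hP₂ : P₂ = G₂) (hP₃ : P₃ = G₃ * x)
    (hKb₁ : Kb₁ = b₁) (hKb₂ : Kb₂ = b₂ + b₂' * x) (hKb₃ : Kb₃ = b₃ + b₃' * x)
    (hG₀ : 0 ≤ G₀) (hG₁ : 0 ≤ G₁) (hG₂ : 0 ≤ G₂) (hG₃ : 0 ≤ G₃) (hb₁ : 0 ≤ b₁) (hb₂ : 0 ≤ b₂) (hb₂' : 0 ≤ b₂') (hb₃ : 0 ≤ b₃)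
    (hb₃' : 0 ≤ b₃') (hα₁ : 0 ≤ α₁) (hα₂ : 0 ≤ α₂) (hα₃ : 0 ≤ α₃) (hη : 0 ≤ η) (hx : 1 ≤ x) (hρ : 0 < ρ)
    (ha₁ : a₁ ≤ α₁ * η) (ha₂ : a₂ ≤ α₂ * η ^ 2) (ha₃ : a₃ ≤ α₃ * η ^ 3)
    (hX1 : 3 * (3 * G₁ * k₂ * b₂' + 3 * G₂ * k₁ * α₁ + 3 * G₂ * k₂ * b₁) ≤ k₁ * G₃ * x)
    (hX2 : 3 * (3 * G₀ * k₂ * α₁ * b₂' + 3 * G₀ * k₃ * b₁ * b₂' + 6 * G₁ * k₂ * α₁ * b₁ + 3 * G₁ * k₃ * b₁ ^ 2 + G₀ * G₃ * k₂ + G₀ * k₂ * b₃' + 3 * G₁ * G₂ * k₂ + 3 * G₁ * k₁ * α₂ + 3 * G₁ * k₂ * b₂) ≤ k₁ * G₃ * x ^ 2)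
    (hX3 : 3 * ((3 * G₀ * k₃ * α₁ * b₁ ^ 2 + G₀ * k₄ * b₁ ^ 3 + 3 * G₀ * G₁ * k₃ * b₂' + 3 * G₀ * G₂ * k₂ * α₁ + 3 * G₀ * G₂ * k₃ * b₁ + 3 * G₀ * k₂ * α₁ * b₂ + 3 * G₀ * k₂ * α₂ * b₁ + 3 * G₀ * k₃ * b₁ * b₂ + 3 * G₁ ^ 2 * k₂ * α₁ + 3 * G₁ ^ 2 * k₃ * b₁ + G₀ * k₁ * α₃ + G₀ * k₂ * b₃) + (6 * G₀ * G₁ * k₃ * α₁ * b₁ + 3 * G₀ * G₁ * k₄ * b₁ ^ 2 + 3 * G₀ * G₁ * G₂ * k₃ + 3 * G₀ * G₁ * k₂ * α₂ + 3 * G₀ * G₁ * k₃ * b₂ + G₁ ^ 3 * k₃) + (3 * G₀ * G₁ ^ 2 * k₃ * α₁ + 3 * G₀ * G₁ ^ 2 * k₄ * b₁) + (G₀ * G₁ ^ 3 * k₄)) ≤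
      k₁ * G₃ * x ^ 3)
    (hrate : G₃ * ρ ^ 3 ≤ (2 / π) ^ 3 * G₀) :
    c₀ *
        (1 * ((128 * B₄ + 1408 * B₃ + 7776 * B₂ + 27648 * B₁ + 24576) * c / Λ ^ 5 * P₀ * (Kb₁ * η + P₁ * η) ^ 3 +
        (64 * B₃ + 480 * B₂ + 1728 * B₁ + 1536) * c / Λ ^ 4 *
          (P₁ * η * (3 * (Kb₁ * η) ^ 2 + 3 * (Kb₁ * η) * (P₁ * η) + (P₁ * η) ^ 2)) +
        3 * ((64 * B₃ + 480 * B₂ + 1728 * B₁ + 1536) * c / Λ ^ 4 * P₀ *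
            ((Kb₁ * η + P₁ * η) * (Kb₂ * η ^ 2 + P₂ * η ^ 2)) +
          (32 * B₂ + 144 * B₁ + 128) * c / Λ ^ 3 *
            (Kb₁ * η * (P₂ * η ^ 2) + P₁ * η * (Kb₂ * η ^ 2) + P₁ * η * (P₂ * η ^ 2))) +
        ((32 * B₂ + 144 * B₁ + 128) * c / Λ ^ 3 * P₀ * (Kb₃ * η ^ 3 + P₃ * η ^ 3) +
          (16 * B₁ + 16) * c / Λ ^ 2 * (P₃ * η ^ 3))) +
          3 * (a₁ * ((64 * B₃ + 480 * B₂ + 1728 * B₁ + 1536) * c / Λ ^ 4 * P₀ * (Kb₁ * η + P₁ * η) ^ 2 +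
        (32 * B₂ + 144 * B₁ + 128) * c / Λ ^ 3 * (P₁ * η * (2 * (Kb₁ * η) + P₁ * η)) +
        ((32 * B₂ + 144 * B₁ + 128) * c / Λ ^ 3 * P₀ * (Kb₂ * η ^ 2 + P₂ * η ^ 2) +
          (16 * B₁ + 16) * c / Λ ^ 2 * (P₂ * η ^ 2)))) +
          3 * (a₂ * ((32 * B₂ + 144 * B₁ + 128) * c / Λ ^ 3 * P₀ * (Kb₁ * η + P₁ * η) + (16 * B₁ + 16) * c / Λ ^ 2 * (P₁ * η))) +
          a₃ * ((16 * B₁ + 16) * c / Λ ^ 2 * P₀)) ≤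
      2 * (c₀ * ((16 * B₁ + 16) * c / Λ ^ 2 * P₀)) * (2 * η / (π * (ρ / x))) ^ 3 := by
  rw [hP₀, hP₁, hP₂, hP₃, hKb₁, hKb₂, hKb₃]
  have hx0 : 0 < x := lt_of_lt_of_le one_pos hx
  have hπ : 0 < π := Real.pi_pos
  have e₁ : (16 * B₁ + 16) * c / Λ ^ 2 = k₁ * c := by rw [hk₁]; ring
  have e₂ : (32 * B₂ + 144 * B₁ + 128) * c / Λ ^ 3 = k₂ * c := by rw [hk₂]; ring
  have e₃ : (64 * B₃ + 480 * B₂ + 1728 * B₁ + 1536) * c / Λ ^ 4 = k₃ * c := by rw [hk₃]; ring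
  have e₄ : (128 * B₄ + 1408 * B₃ + 7776 * B₂ + 27648 * B₁ + 24576) * c / Λ ^ 5 = k₄ * c := by rw [hk₄]; ring
  rw [e₁, e₂, e₃, e₄]
  -- step 1: the multiplier data in scale form
  have step1 : c₀ *
      (1 * ((k₄ * c) * (G₀ / x ^ 2) * (b₁ * η + (G₁ / x) * η) ^ 3 +
      (k₃ * c) *
      ((G₁ / x) * η * (3 * (b₁ * η) ^ 2 + 3 * (b₁ * η) * ((G₁ / x) * η) + ((G₁ / x) * η) ^ 2)) +
      3 * ((k₃ * c) * (G₀ / x ^ 2) *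
      ((b₁ * η + (G₁ / x) * η) * ((b₂ + b₂' * x) * η ^ 2 + G₂ * η ^ 2)) +
      (k₂ * c) *
      (b₁ * η * (G₂ * η ^ 2) + (G₁ / x) * η * ((b₂ + b₂' * x) * η ^ 2) + (G₁ / x) * η * (G₂ * η ^ 2))) +
      ((k₂ * c) * (G₀ / x ^ 2) * ((b₃ + b₃' * x) * η ^ 3 + (G₃ * x) * η ^ 3) +
      (k₁ * c) * ((G₃ * x) * η ^ 3))) +
      3 * (a₁ * ((k₃ * c) * (G₀ / x ^ 2) * (b₁ * η + (G₁ / x) * η) ^ 2 +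
      (k₂ * c) * ((G₁ / x) * η * (2 * (b₁ * η) + (G₁ / x) * η)) +
      ((k₂ * c) * (G₀ / x ^ 2) * ((b₂ + b₂' * x) * η ^ 2 + G₂ * η ^ 2) +
      (k₁ * c) * (G₂ * η ^ 2)))) +
      3 * (a₂ * ((k₂ * c) * (G₀ / x ^ 2) * (b₁ * η + (G₁ / x) * η) + (k₁ * c) * ((G₁ / x) * η))) +
      a₃ * ((k₁ * c) * (G₀ / x ^ 2))) ≤
      c₀ *
      (1 * ((k₄ * c) * (G₀ / x ^ 2) * (b₁ * η + (G₁ / x) * η) ^ 3 +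
      (k₃ * c) *
      ((G₁ / x) * η * (3 * (b₁ * η) ^ 2 + 3 * (b₁ * η) * ((G₁ / x) * η) + ((G₁ / x) * η) ^ 2)) +
      3 * ((k₃ * c) * (G₀ / x ^ 2) *
      ((b₁ * η + (G₁ / x) * η) * ((b₂ + b₂' * x) * η ^ 2 + G₂ * η ^ 2)) +
      (k₂ * c) *
      (b₁ * η * (G₂ * η ^ 2) + (G₁ / x) * η * ((b₂ + b₂' * x) * η ^ 2) + (G₁ / x) * η * (G₂ * η ^ 2))) +
      ((k₂ * c) * (G₀ / x ^ 2) * ((b₃ + b₃' * x) * η ^ 3 + (G₃ * x) * η ^ 3) +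
      (k₁ * c) * ((G₃ * x) * η ^ 3))) +
      3 * ((α₁ * η) * ((k₃ * c) * (G₀ / x ^ 2) * (b₁ * η + (G₁ / x) * η) ^ 2 +
      (k₂ * c) * ((G₁ / x) * η * (2 * (b₁ * η) + (G₁ / x) * η)) +
      ((k₂ * c) * (G₀ / x ^ 2) * ((b₂ + b₂' * x) * η ^ 2 + G₂ * η ^ 2) +
      (k₁ * c) * (G₂ * η ^ 2)))) +
      3 * ((α₂ * η ^ 2) * ((k₂ * c) * (G₀ / x ^ 2) * (b₁ * η + (G₁ / x) * η) + (k₁ * c) * ((G₁ / x) * η))) +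
      (α₃ * η ^ 3) * ((k₁ * c) * (G₀ / x ^ 2))) := by
    gcongr
  refine step1.trans ?_
  -- step 2: Laurent expansion in `x`
  have e : c₀ *
      (1 * ((k₄ * c) * (G₀ / x ^ 2) * (b₁ * η + (G₁ / x) * η) ^ 3 +
      (k₃ * c) *
      ((G₁ / x) * η * (3 * (b₁ * η) ^ 2 + 3 * (b₁ * η) * ((G₁ / x) * η) + ((G₁ / x) * η) ^ 2)) +
      3 * ((k₃ * c) * (G₀ / x ^ 2) *
      ((b₁ * η + (G₁ / x) * η) * ((b₂ + b₂' * x) * η ^ 2 + G₂ * η ^ 2)) +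
      (k₂ * c) *
      (b₁ * η * (G₂ * η ^ 2) + (G₁ / x) * η * ((b₂ + b₂' * x) * η ^ 2) + (G₁ / x) * η * (G₂ * η ^ 2))) +
      ((k₂ * c) * (G₀ / x ^ 2) * ((b₃ + b₃' * x) * η ^ 3 + (G₃ * x) * η ^ 3) +
      (k₁ * c) * ((G₃ * x) * η ^ 3))) +
      3 * ((α₁ * η) * ((k₃ * c) * (G₀ / x ^ 2) * (b₁ * η + (G₁ / x) * η) ^ 2 +
      (k₂ * c) * ((G₁ / x) * η * (2 * (b₁ * η) + (G₁ / x) * η)) +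
      ((k₂ * c) * (G₀ / x ^ 2) * ((b₂ + b₂' * x) * η ^ 2 + G₂ * η ^ 2) +
      (k₁ * c) * (G₂ * η ^ 2)))) +
      3 * ((α₂ * η ^ 2) * ((k₂ * c) * (G₀ / x ^ 2) * (b₁ * η + (G₁ / x) * η) + (k₁ * c) * ((G₁ / x) * η))) +
      (α₃ * η ^ 3) * ((k₁ * c) * (G₀ / x ^ 2))) =
      c₀ * c * η ^ 3 * (k₁ * G₃ * x + (3 * G₁ * k₂ * b₂' + 3 * G₂ * k₁ * α₁ + 3 * G₂ * k₂ * b₁) + (3 * G₀ * k₂ * α₁ * b₂' + 3 * G₀ * k₃ * b₁ * b₂' + 6 * G₁ * k₂ * α₁ * b₁ + 3 * G₁ * k₃ * b₁ ^ 2 + G₀ * G₃ * k₂ + G₀ * k₂ * b₃' + 3 * G₁ * G₂ * k₂ + 3 * G₁ * k₁ * α₂ + 3 * G₁ * k₂ * b₂) / x +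
        (3 * G₀ * k₃ * α₁ * b₁ ^ 2 + G₀ * k₄ * b₁ ^ 3 + 3 * G₀ * G₁ * k₃ * b₂' + 3 * G₀ * G₂ * k₂ * α₁ + 3 * G₀ * G₂ * k₃ * b₁ + 3 * G₀ * k₂ * α₁ * b₂ + 3 * G₀ * k₂ * α₂ * b₁ + 3 * G₀ * k₃ * b₁ * b₂ + 3 * G₁ ^ 2 * k₂ * α₁ + 3 * G₁ ^ 2 * k₃ * b₁ + G₀ * k₁ * α₃ + G₀ * k₂ * b₃) / x ^ 2 +
        (6 * G₀ * G₁ * k₃ * α₁ * b₁ + 3 * G₀ * G₁ * k₄ * b₁ ^ 2 + 3 * G₀ * G₁ * G₂ * k₃ + 3 * G₀ * G₁ * k₂ * α₂ + 3 * G₀ * G₁ * k₃ * b₂ + G₁ ^ 3 * k₃) / x ^ 3 +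
        (3 * G₀ * G₁ ^ 2 * k₃ * α₁ + 3 * G₀ * G₁ ^ 2 * k₄ * b₁) / x ^ 4 + (G₀ * G₁ ^ 3 * k₄) / x ^ 5) := by
    field_simp
    ring
  rw [e]
  -- step 3: flatten the deep terms to `x⁻²` and use the thresholds
  have p0 : 0 ≤ 3 * G₁ * k₂ * b₂' + 3 * G₂ * k₁ * α₁ + 3 * G₂ * k₂ * b₁ := by positivity
  have p1 : 0 ≤ 3 * G₀ * k₂ * α₁ * b₂' + 3 * G₀ * k₃ * b₁ * b₂' + 6 * G₁ * k₂ * α₁ * b₁ + 3 * G₁ * k₃ * b₁ ^ 2 + G₀ * G₃ * k₂ + G₀ * k₂ * b₃' + 3 * G₁ * G₂ * k₂ + 3 * G₁ * k₁ * α₂ + 3 * G₁ * k₂ * b₂ := by positivity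
  have p2 : 0 ≤ 3 * G₀ * k₃ * α₁ * b₁ ^ 2 + G₀ * k₄ * b₁ ^ 3 + 3 * G₀ * G₁ * k₃ * b₂' + 3 * G₀ * G₂ * k₂ * α₁ + 3 * G₀ * G₂ * k₃ * b₁ + 3 * G₀ * k₂ * α₁ * b₂ + 3 * G₀ * k₂ * α₂ * b₁ + 3 * G₀ * k₃ * b₁ * b₂ + 3 * G₁ ^ 2 * k₂ * α₁ + 3 * G₁ ^ 2 * k₃ * b₁ + G₀ * k₁ * α₃ + G₀ * k₂ * b₃ := by positivity
  have p3 : 0 ≤ 6 * G₀ * G₁ * k₃ * α₁ * b₁ + 3 * G₀ * G₁ * k₄ * b₁ ^ 2 + 3 * G₀ * G₁ * G₂ * k₃ + 3 * G₀ * G₁ * k₂ * α₂ + 3 * G₀ * G₁ * k₃ * b₂ + G₁ ^ 3 * k₃ := by positivity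
  have p4 : 0 ≤ 3 * G₀ * G₁ ^ 2 * k₃ * α₁ + 3 * G₀ * G₁ ^ 2 * k₄ * b₁ := by positivity
  have p5 : 0 ≤ G₀ * G₁ ^ 3 * k₄ := by positivity
  set T0 : ℝ := 3 * G₁ * k₂ * b₂' + 3 * G₂ * k₁ * α₁ + 3 * G₂ * k₂ * b₁ with hT0
  set T1 : ℝ := 3 * G₀ * k₂ * α₁ * b₂' + 3 * G₀ * k₃ * b₁ * b₂' + 6 * G₁ * k₂ * α₁ * b₁ + 3 * G₁ * k₃ * b₁ ^ 2 + G₀ * G₃ * k₂ + G₀ * k₂ * b₃' + 3 * G₁ * G₂ * k₂ + 3 * G₁ * k₁ * α₂ + 3 * G₁ * k₂ * b₂ with hT1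
  set T2 : ℝ := 3 * G₀ * k₃ * α₁ * b₁ ^ 2 + G₀ * k₄ * b₁ ^ 3 + 3 * G₀ * G₁ * k₃ * b₂' + 3 * G₀ * G₂ * k₂ * α₁ + 3 * G₀ * G₂ * k₃ * b₁ + 3 * G₀ * k₂ * α₁ * b₂ + 3 * G₀ * k₂ * α₂ * b₁ + 3 * G₀ * k₃ * b₁ * b₂ + 3 * G₁ ^ 2 * k₂ * α₁ + 3 * G₁ ^ 2 * k₃ * b₁ + G₀ * k₁ * α₃ + G₀ * k₂ * b₃ with hT2
  set T3 : ℝ := 6 * G₀ * G₁ * k₃ * α₁ * b₁ + 3 * G₀ * G₁ * k₄ * b₁ ^ 2 + 3 * G₀ * G₁ * G₂ * k₃ + 3 * G₀ * G₁ * k₂ * α₂ + 3 * G₀ * G₁ * k₃ * b₂ + G₁ ^ 3 * k₃ with hT3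
  set T4 : ℝ := 3 * G₀ * G₁ ^ 2 * k₃ * α₁ + 3 * G₀ * G₁ ^ 2 * k₄ * b₁ with hT4
  set T5 : ℝ := G₀ * G₁ ^ 3 * k₄ with hT5
  have f₃ : T3 / x ^ 3 ≤ T3 / x ^ 2 := div_pow_le_div_sq p3 hx (by norm_num)
  have f₄ : T4 / x ^ 4 ≤ T4 / x ^ 2 := div_pow_le_div_sq p4 hx (by norm_num)
  have f₅ : T5 / x ^ 5 ≤ T5 / x ^ 2 := div_pow_le_div_sq p5 hx (by norm_num)
  have g₁ : T0 ≤ k₁ * G₃ * x / 3 := by linarith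
  have g₂ : T1 / x ≤ k₁ * G₃ * x / 3 := by
    rw [div_le_iff₀ hx0, show k₁ * G₃ * x / 3 * x = k₁ * G₃ * x ^ 2 / 3 by ring]; linarith
  have g₃ : (T2 + T3 + T4 + T5) / x ^ 2 ≤ k₁ * G₃ * x / 3 := by
    rw [div_le_iff₀ (by positivity), show k₁ * G₃ * x / 3 * x ^ 2 = k₁ * G₃ * x ^ 3 / 3 by ring]; linarith
  have hsum : k₁ * G₃ * x + T0 + T1 / x + T2 / x ^ 2 + T3 / x ^ 3 + T4 / x ^ 4 + T5 / x ^ 5 ≤ 2 * (k₁ * G₃ * x) := by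
    have hs : T2 / x ^ 2 + T3 / x ^ 2 + T4 / x ^ 2 + T5 / x ^ 2 = (T2 + T3 + T4 + T5) / x ^ 2 := by ring
    linarith
  have hG₃ρ : G₃ ≤ (2 / π) ^ 3 * G₀ / ρ ^ 3 := by rw [le_div_iff₀ (by positivity)]; exact hrate
  calc c₀ * c * η ^ 3 * _ ≤ c₀ * c * η ^ 3 * (2 * (k₁ * G₃ * x)) := mul_le_mul_of_nonneg_left hsum (by positivity)
    _ = (2 * c₀ * c * η ^ 3 * k₁ * x) * G₃ := by ring
    _ ≤ (2 * c₀ * c * η ^ 3 * k₁ * x) * ((2 / π) ^ 3 * G₀ / ρ ^ 3) := mul_le_mul_of_nonneg_left hG₃ρ (by positivity)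
    _ = 2 * (c₀ * (k₁ * c * (G₀ / x ^ 2))) * (2 * η / (π * (ρ / x))) ^ 3 := by
      field_simp


/-! ### §2 Order two along the sector in the two-scale class -/

/-- **Order-two tangent rate inequality of the increment pair, solved in the two-scale class** (`A₀ = 2c₀K₁P₀`, rate `ρ₃/x`): the Leibniz bound
is `≤ A₀·(2η/(πρ₃/x))²` given `a_k ≤ α_kη^k`, the two threshold conditions and `G₂ρ₃² ≤ (2/π)²G₀`. [cite: BenfattoGiulianiMastropietro2006, §3 (3.2)–(3.8)] -/
theorem incr_rate_two_le {c₀ c Λ B₁ B₂ B₃ k₁ k₂ k₃ P₀ P₁ P₂ Kb₁ Kb₂ G₀ G₁ G₂ b₁ b₂ b₂' a₁ a₂ α₁ α₂ η ρ₃ x : ℝ}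
    (hc₀ : 0 ≤ c₀) (hc : 0 ≤ c)
    (hk₁ : k₁ = (16 * B₁ + 16) / Λ ^ 2) (hk₂ : k₂ = (32 * B₂ + 144 * B₁ + 128) / Λ ^ 3)
    (hk₃ : k₃ = (64 * B₃ + 480 * B₂ + 1728 * B₁ + 1536) / Λ ^ 4)
    (hk₁0 : 0 ≤ k₁) (hk₂0 : 0 ≤ k₂) (hk₃0 : 0 ≤ k₃)
    (hP₀ : P₀ = G₀ / x ^ 2) (hP₁ : P₁ = G₁ / x) (hP₂ : P₂ = G₂)
    (hKb₁ : Kb₁ = b₁) (hKb₂ : Kb₂ = b₂ + b₂' * x)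
    (hG₀ : 0 ≤ G₀) (hG₁ : 0 ≤ G₁) (hG₂ : 0 ≤ G₂) (hb₁ : 0 ≤ b₁) (hb₂ : 0 ≤ b₂) (hb₂' : 0 ≤ b₂')
    (hα₁ : 0 ≤ α₁) (hα₂ : 0 ≤ α₂) (hη : 0 ≤ η) (hx : 1 ≤ x) (hρ₃ : 0 < ρ₃)
    (ha₁ : a₁ ≤ α₁ * η) (ha₂ : a₂ ≤ α₂ * η ^ 2)
    (hY1 : 2 * (G₀ * k₂ * b₂' + 2 * G₁ * k₁ * α₁ + 2 * G₁ * k₂ * b₁) ≤ k₁ * G₂ * x)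
    (hY2 : 2 * ((2 * G₀ * k₂ * α₁ * b₁ + G₀ * k₃ * b₁ ^ 2 + G₀ * G₂ * k₂ + G₀ * k₁ * α₂ + G₀ * k₂ * b₂ + G₁ ^ 2 * k₂) + (2 * G₀ * G₁ * k₂ * α₁ + 2 * G₀ * G₁ * k₃ * b₁) + (G₀ * G₁ ^ 2 * k₃)) ≤ k₁ * G₂ * x ^ 2)
    (hrate : G₂ * ρ₃ ^ 2 ≤ (2 / π) ^ 2 * G₀) :
    c₀ *
        (1 * ((64 * B₃ + 480 * B₂ + 1728 * B₁ + 1536) * c / Λ ^ 4 * P₀ * (Kb₁ * η + P₁ * η) ^ 2 +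
        (32 * B₂ + 144 * B₁ + 128) * c / Λ ^ 3 * (P₁ * η * (2 * (Kb₁ * η) + P₁ * η)) +
        ((32 * B₂ + 144 * B₁ + 128) * c / Λ ^ 3 * P₀ * (Kb₂ * η ^ 2 + P₂ * η ^ 2) +
          (16 * B₁ + 16) * c / Λ ^ 2 * (P₂ * η ^ 2))) +
          2 * (a₁ * ((32 * B₂ + 144 * B₁ + 128) * c / Λ ^ 3 * P₀ * (Kb₁ * η + P₁ * η) + (16 * B₁ + 16) * c / Λ ^ 2 * (P₁ * η))) +
          a₂ * ((16 * B₁ + 16) * c / Λ ^ 2 * P₀)) ≤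
      2 * (c₀ * ((16 * B₁ + 16) * c / Λ ^ 2 * P₀)) * (2 * η / (π * (ρ₃ / x))) ^ 2 := by
  rw [hP₀, hP₁, hP₂, hKb₁, hKb₂]
  have hx0 : 0 < x := lt_of_lt_of_le one_pos hx
  have hπ : 0 < π := Real.pi_pos
  have e₁ : (16 * B₁ + 16) * c / Λ ^ 2 = k₁ * c := by rw [hk₁]; ring
  have e₂ : (32 * B₂ + 144 * B₁ + 128) * c / Λ ^ 3 = k₂ * c := by rw [hk₂]; ring
  have e₃ : (64 * B₃ + 480 * B₂ + 1728 * B₁ + 1536) * c / Λ ^ 4 = k₃ * c := by rw [hk₃]; ring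
  rw [e₁, e₂, e₃]
  have step1 : c₀ *
      (1 * ((k₃ * c) * (G₀ / x ^ 2) * (b₁ * η + (G₁ / x) * η) ^ 2 +
      (k₂ * c) * ((G₁ / x) * η * (2 * (b₁ * η) + (G₁ / x) * η)) +
      ((k₂ * c) * (G₀ / x ^ 2) * ((b₂ + b₂' * x) * η ^ 2 + G₂ * η ^ 2) +
      (k₁ * c) * (G₂ * η ^ 2))) +
      2 * (a₁ * ((k₂ * c) * (G₀ / x ^ 2) * (b₁ * η + (G₁ / x) * η) + (k₁ * c) * ((G₁ / x) * η))) +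
      a₂ * ((k₁ * c) * (G₀ / x ^ 2))) ≤
      c₀ *
      (1 * ((k₃ * c) * (G₀ / x ^ 2) * (b₁ * η + (G₁ / x) * η) ^ 2 +
      (k₂ * c) * ((G₁ / x) * η * (2 * (b₁ * η) + (G₁ / x) * η)) +
      ((k₂ * c) * (G₀ / x ^ 2) * ((b₂ + b₂' * x) * η ^ 2 + G₂ * η ^ 2) +
      (k₁ * c) * (G₂ * η ^ 2))) +
      2 * ((α₁ * η) * ((k₂ * c) * (G₀ / x ^ 2) * (b₁ * η + (G₁ / x) * η) + (k₁ * c) * ((G₁ / x) * η))) +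
      (α₂ * η ^ 2) * ((k₁ * c) * (G₀ / x ^ 2))) := by
    gcongr
  refine step1.trans ?_
  have e : c₀ *
      (1 * ((k₃ * c) * (G₀ / x ^ 2) * (b₁ * η + (G₁ / x) * η) ^ 2 +
      (k₂ * c) * ((G₁ / x) * η * (2 * (b₁ * η) + (G₁ / x) * η)) +
      ((k₂ * c) * (G₀ / x ^ 2) * ((b₂ + b₂' * x) * η ^ 2 + G₂ * η ^ 2) +
      (k₁ * c) * (G₂ * η ^ 2))) +
      2 * ((α₁ * η) * ((k₂ * c) * (G₀ / x ^ 2) * (b₁ * η + (G₁ / x) * η) + (k₁ * c) * ((G₁ / x) * η))) +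
      (α₂ * η ^ 2) * ((k₁ * c) * (G₀ / x ^ 2))) =
      c₀ * c * η ^ 2 * (k₁ * G₂ + (G₀ * k₂ * b₂' + 2 * G₁ * k₁ * α₁ + 2 * G₁ * k₂ * b₁) / x + (2 * G₀ * k₂ * α₁ * b₁ + G₀ * k₃ * b₁ ^ 2 + G₀ * G₂ * k₂ + G₀ * k₁ * α₂ + G₀ * k₂ * b₂ + G₁ ^ 2 * k₂) / x ^ 2 +
        (2 * G₀ * G₁ * k₂ * α₁ + 2 * G₀ * G₁ * k₃ * b₁) / x ^ 3 + (G₀ * G₁ ^ 2 * k₃) / x ^ 4) := by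
    field_simp
    ring
  rw [e]
  have p1 : 0 ≤ G₀ * k₂ * b₂' + 2 * G₁ * k₁ * α₁ + 2 * G₁ * k₂ * b₁ := by positivity
  have p2 : 0 ≤ 2 * G₀ * k₂ * α₁ * b₁ + G₀ * k₃ * b₁ ^ 2 + G₀ * G₂ * k₂ + G₀ * k₁ * α₂ + G₀ * k₂ * b₂ + G₁ ^ 2 * k₂ := by positivity
  have p3 : 0 ≤ 2 * G₀ * G₁ * k₂ * α₁ + 2 * G₀ * G₁ * k₃ * b₁ := by positivity
  have p4 : 0 ≤ G₀ * G₁ ^ 2 * k₃ := by positivity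
  set T1 : ℝ := G₀ * k₂ * b₂' + 2 * G₁ * k₁ * α₁ + 2 * G₁ * k₂ * b₁ with hT1
  set T2 : ℝ := 2 * G₀ * k₂ * α₁ * b₁ + G₀ * k₃ * b₁ ^ 2 + G₀ * G₂ * k₂ + G₀ * k₁ * α₂ + G₀ * k₂ * b₂ + G₁ ^ 2 * k₂ with hT2
  set T3 : ℝ := 2 * G₀ * G₁ * k₂ * α₁ + 2 * G₀ * G₁ * k₃ * b₁ with hT3
  set T4 : ℝ := G₀ * G₁ ^ 2 * k₃ with hT4
  have f₃ : T3 / x ^ 3 ≤ T3 / x ^ 2 := div_pow_le_div_sq p3 hx (by norm_num)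
  have f₄ : T4 / x ^ 4 ≤ T4 / x ^ 2 := div_pow_le_div_sq p4 hx (by norm_num)
  have g₁ : T1 / x ≤ k₁ * G₂ / 2 := by
    rw [div_le_iff₀ hx0, show k₁ * G₂ / 2 * x = k₁ * G₂ * x / 2 by ring]; linarith
  have g₂ : (T2 + T3 + T4) / x ^ 2 ≤ k₁ * G₂ / 2 := by
    rw [div_le_iff₀ (by positivity), show k₁ * G₂ / 2 * x ^ 2 = k₁ * G₂ * x ^ 2 / 2 by ring]; linarith
  have hsum : k₁ * G₂ + T1 / x + T2 / x ^ 2 + T3 / x ^ 3 + T4 / x ^ 4 ≤ 2 * (k₁ * G₂) := by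
    have hs : T2 / x ^ 2 + T3 / x ^ 2 + T4 / x ^ 2 = (T2 + T3 + T4) / x ^ 2 := by ring
    linarith
  have hG₂ρ : G₂ ≤ (2 / π) ^ 2 * G₀ / ρ₃ ^ 2 := by rw [le_div_iff₀ (by positivity)]; exact hrate
  calc c₀ * c * η ^ 2 * _ ≤ c₀ * c * η ^ 2 * (2 * (k₁ * G₂)) := mul_le_mul_of_nonneg_left hsum (by positivity)
    _ = (2 * c₀ * c * η ^ 2 * k₁) * G₂ := by ring
    _ ≤ (2 * c₀ * c * η ^ 2 * k₁) * ((2 / π) ^ 2 * G₀ / ρ₃ ^ 2) := mul_le_mul_of_nonneg_left hG₂ρ (by positivity)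
    _ = 2 * (c₀ * (k₁ * c * (G₀ / x ^ 2))) * (2 * η / (π * (ρ₃ / x))) ^ 2 := by
      field_simp


/-! ### §3 The time direction: a `P₀`-free level condition -/

/-- **Time rate inequality of the increment pair from its reduced (`P₀`-free) form**: with `A₀ = 2c₀K₁P₀`, the time Leibniz bound (every term carries
the factor `P₀`) is `≤ A₀·(4/(s₀·2M))³` as soon as the level condition `ht` holds — the same for every piece. [cite: BenfattoGiulianiMastropietro2006, §3 (3.2)–(3.8)] -/
theorem incr_rate_time_le {M : ℕ} {c₀ c Λ β B₁ B₂ B₃ B₄ P₀ at₁ at₂ at₃ s₀ : ℝ} (hc₀ : 0 ≤ c₀) (hP₀ : 0 ≤ P₀)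
    (ht : (2 * π / β) ^ 3 * ((128 * B₄ + 1216 * B₃ + 6912 * B₂ + 26112 * B₁ + 24576) * c / Λ ^ 5) +
          3 * (at₁ * ((2 * π / β) ^ 2 * ((64 * B₃ + 416 * B₂ + 1600 * B₁ + 1536) * c / Λ ^ 4))) +
          3 * (at₂ * ((2 * π / β) * ((32 * B₂ + 128 * B₁ + 128) * c / Λ ^ 3))) + at₃ * ((16 * B₁ + 16) * c / Λ ^ 2) ≤
      2 * ((16 * B₁ + 16) * c / Λ ^ 2) * (4 / (s₀ * (2 * M : ℕ))) ^ 3) :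
    c₀ *
        (1 * ((2 * π / β) ^ 3 * ((128 * B₄ + 1216 * B₃ + 6912 * B₂ + 26112 * B₁ + 24576) * c / Λ ^ 5 * P₀)) +
          3 * (at₁ * ((2 * π / β) ^ 2 * ((64 * B₃ + 416 * B₂ + 1600 * B₁ + 1536) * c / Λ ^ 4 * P₀))) +
          3 * (at₂ * ((2 * π / β) * ((32 * B₂ + 128 * B₁ + 128) * c / Λ ^ 3 * P₀))) +
          at₃ * ((16 * B₁ + 16) * c / Λ ^ 2 * P₀)) ≤
      2 * (c₀ * ((16 * B₁ + 16) * c / Λ ^ 2 * P₀)) * (4 / (s₀ * (2 * M : ℕ))) ^ 3 := by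
  have e : c₀ *
      (1 * ((2 * π / β) ^ 3 * ((128 * B₄ + 1216 * B₃ + 6912 * B₂ + 26112 * B₁ + 24576) * c / Λ ^ 5 * P₀)) +
      3 * (at₁ * ((2 * π / β) ^ 2 * ((64 * B₃ + 416 * B₂ + 1600 * B₁ + 1536) * c / Λ ^ 4 * P₀))) +
      3 * (at₂ * ((2 * π / β) * ((32 * B₂ + 128 * B₁ + 128) * c / Λ ^ 3 * P₀))) +
      at₃ * ((16 * B₁ + 16) * c / Λ ^ 2 * P₀)) =
      c₀ * P₀ * ((2 * π / β) ^ 3 * ((128 * B₄ + 1216 * B₃ + 6912 * B₂ + 26112 * B₁ + 24576) * c / Λ ^ 5) +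
        3 * (at₁ * ((2 * π / β) ^ 2 * ((64 * B₃ + 416 * B₂ + 1600 * B₁ + 1536) * c / Λ ^ 4))) +
        3 * (at₂ * ((2 * π / β) * ((32 * B₂ + 128 * B₁ + 128) * c / Λ ^ 3))) + at₃ * ((16 * B₁ + 16) * c / Λ ^ 2)) := by
    ring
  rw [e]
  calc c₀ * P₀ * _ ≤ c₀ * P₀ * (2 * ((16 * B₁ + 16) * c / Λ ^ 2) * (4 / (s₀ * (2 * M : ℕ))) ^ 3) :=
        mul_le_mul_of_nonneg_left ht (mul_nonneg hc₀ hP₀)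
    _ = 2 * (c₀ * ((16 * B₁ + 16) * c / Λ ^ 2 * P₀)) * (4 / (s₀ * (2 * M : ℕ))) ^ 3 := by ring

end Summit.HubbardSuperconductivity.HubbardSuperconductivity.Theorems.TorusFourierL2

end
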